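import Summits.BirchSwinnertonDyer.BirchSwinnertonDyer.Theorems.PrintCf2RamifiedOffTYZEvenOmegaIdentity
import Summits.BirchSwinnertonDyer.BirchSwinnertonDyer.Theorems.PrintCf2RamifiedOffTYZLowerHalfRhoDichotomy
import HarnessLib

/-!
# Crux `PrintCf2.RamifiedOffTYZOfFacts` (stmt-BirchSwinnertonDyer-20509), line `offtyz-v7`, LEAD cycle 16 (cruxlead-20509 g15):
# THE EVEN LOWER HALF OF C⁺ FROM ONE WITNESS POINT — g14's `two_dvd_scriptL_even_allk_of_facts` with the Mordell–Weil generator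
# replaced by ANY rational point whose abscissa is outside `⟨−1, 2, n⟩·ℚ^{×2}`

THEOREMS ONLY (no `def`, no named fact, no `sorry`), `--supports stmt-BirchSwinnertonDyer-20509` (helper toward C⁺ = item 23431).  g14's theorem
(p754196, `…EvenOmegaIdentity` §5) concludes `2 ∣ 𝓛(n)` on the even class `n = 2∏pᵢ ≡ 6 (8)`, `#Sel₂ = 2^{2+s}` (`s ≥ 2`), `r_an = 1`, from a
GENERATOR `R = (x, y)` of `E_n(ℚ)` modulo torsion with `x ∉ ⟨−1, 2, n⟩·ℚ^{×2}` (two four-fold exclusions `hx`, `hx2`).  Using a generator as a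
hypothesis requires the full Mordell–Weil group.  Here the SAME conclusion is derived from ONE rational point `(x₀, y₀) ∈ E_n(ℚ)` with
`x₀ ∉ ⟨−1, 2, n⟩·ℚ^{×2}`: the `x`-class `P ↦ [x(P)] ∈ ℚ^×/ℚ^{×2}` is a homomorphism (Silverman X.1.4, tree `twoDescentComponent_add`), the classes of the
torsion points lie in `{1, [−1], [n], [−n]}` (`E_n(ℚ)_tors = E_n[2]`, tree), and the classes `[±2^b n^c]` form a subgroup; so if the generator were
special (or `O`), every rational point — in particular the witness — would be special.

* §1 the exponent form `[u] = [−1]^a [2]^b [n]^c` of «special» and its algebra (closed under products; contains the torsion classes; ⟺ the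
  eight-fold `∃ r, x = ±r², ±n r², ±2r², ±2n r²` description for abscissae);
* §2 `exists_generator_not_special₂_of_point` — square-free `n`, `rank E_n(ℚ) ≤ 1`, a witness point ⟹ a generator modulo torsion with BOTH of
  g14's exclusions;
* §3 ★ `two_dvd_scriptL_even_allk_of_point_of_facts` — **granted `tyz_cmPointRingClassFrobeniusValueData ∧ thm11_parity_of_scriptL ∧ GZK`: for
  `n = 2p₁⋯p_k` square-free with `∏pᵢ ≡ 3 (4)`, `#Sel₂(E_n) = 2^{2+s}` (`s ≥ 2`), `ord_{s=1}L(E_n,s) = 1` and ANY `(x₀,y₀) ∈ E_n(ℚ)` with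
  `x₀ ∉ ⟨−1,2,n⟩·ℚ^{×2}`, every integer `L` with `𝓛(n)² = L²` is even.**

Census context (crux workfile `Lines/offtyz_v7_SpecialStratum.md` §8, this cycle's Cassels-pairing instrument): the complementary even special stratum
is 314/762 = 41 % of the two-prime even jump-one class (n ≤ 10⁵) and 15 % at k = 3.  BSD is not proved by any of this; no route item is closed.

References: [cite: TianYuanZhang2017, Thm. 1.1, §1 (ρ(n)), §3]; [cite: SilvermanAEC2009, Prop. X.1.4, Prop. X.4.9]; [cite: Knapp1993, Ch. V, Thm. 5.2];
[cite: HeathBrown1994SelmerCongruentII, Appendix (Monsky)]; [cite: Darmon2004, Thm. 3.22].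
-/

noncomputable section

open scoped Classical

open WeierstrassCurve WeierstrassCurve.Affine WeierstrassCurve.Affine.Point
  Literature.NumberTheory.EllipticCurves Literature.NumberTheory.EllipticCurves.TianYuanZhang2017
  Literature.NumberTheory.EllipticCurves.TianYuanZhang2017.RhoMonskyKernel
  Literature.NumberTheory.EllipticCurves.TwoDescentLocal

set_option autoImplicit false

namespace Summit.BirchSwinnertonDyer.PrintCf2.SpecialStratum

variable {n : ℕ}

/-! ## §1 The exponent form of «special» in `ℚ^×/ℚ^{×2}` -/

/-- `E_n` has the rational `2`-torsion `0, −n, n` (in this order). [folklore] -/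
private theorem hsplit₂ (n : ℕ) : (congruentNumberCurve n).toAffine.SplitTwoTorsion 0 (-(n : ℚ)) n :=
  (splitTwoTorsion_cn n).swap₁₂

/-- `[g·t²] = [g]`. [folklore] -/
private theorem sqClass_mul_sq₂ {g t : ℚ} (hg : g ≠ 0) (ht : t ≠ 0) : sqClass (g * t ^ 2) = sqClass g := by
  rw [sqClass_mul hg (pow_ne_zero 2 ht), sqClass_sq, SqUnits.mul_one]

/-- In `ℚ^×/ℚ^{×2}`, `u ^ a = u ^ (a % 2)`. [folklore] -/
private theorem sqUnits_pow_mod_two (u : SqUnits ℚ) (a : ℕ) : u ^ a = u ^ (a % 2) := by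
  have h2 : u ^ 2 = 1 := by rw [pow_two, SqUnits.mul_self]
  conv_lhs => rw [← Nat.div_add_mod a 2, pow_add, pow_mul, h2, one_pow, one_mul]

/-- **Products of special classes are special** (exponent form). [folklore] -/
theorem specialClass_mul {u v : SqUnits ℚ}
    (hu : ∃ a b c : ℕ, u = sqClass (-1 : ℚ) ^ a * sqClass (2 : ℚ) ^ b * sqClass (n : ℚ) ^ c)
    (hv : ∃ a b c : ℕ, v = sqClass (-1 : ℚ) ^ a * sqClass (2 : ℚ) ^ b * sqClass (n : ℚ) ^ c) :
    ∃ a b c : ℕ, u * v = sqClass (-1 : ℚ) ^ a * sqClass (2 : ℚ) ^ b * sqClass (n : ℚ) ^ c := by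
  obtain ⟨a, b, c, rfl⟩ := hu
  obtain ⟨a', b', c', rfl⟩ := hv
  exact ⟨a + a', b + b', c + c', by rw [pow_add, pow_add, pow_add]; simp only [mul_assoc, mul_comm, mul_left_comm]⟩

/-- The torsion classes `1, [−1], [n], [−n]` are special. [folklore] -/
theorem specialClass_of_torsionClass (hn : n ≠ 0) {u : SqUnits ℚ}
    (h : u = 1 ∨ u = sqClass (-1 : ℚ) ∨ u = sqClass (n : ℚ) ∨ u = sqClass (-(n : ℚ))) :
    ∃ a b c : ℕ, u = sqClass (-1 : ℚ) ^ a * sqClass (2 : ℚ) ^ b * sqClass (n : ℚ) ^ c := by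
  have hN0 : (n : ℚ) ≠ 0 := by exact_mod_cast hn
  rcases h with rfl | rfl | rfl | rfl
  · exact ⟨0, 0, 0, by simp⟩
  · exact ⟨1, 0, 0, by simp⟩
  · exact ⟨0, 0, 1, by simp⟩
  · exact ⟨1, 0, 1, by rw [show (-(n : ℚ)) = (-1) * n by ring, sqClass_mul (by norm_num) hN0]; simp⟩

/-- From the eight-fold description of a special abscissa to the exponent form of its class (for `x ≠ 0`). [folklore] -/
theorem specialClass_of_exists (hn : n ≠ 0) {x : ℚ} (hx0 : x ≠ 0)
    (h : (∃ r : ℚ, x = r ^ 2 ∨ x = -r ^ 2 ∨ x = n * r ^ 2 ∨ x = -(n * r ^ 2)) ∨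
      (∃ r : ℚ, x = 2 * r ^ 2 ∨ x = -(2 * r ^ 2) ∨ x = 2 * n * r ^ 2 ∨ x = -(2 * n * r ^ 2))) :
    ∃ a b c : ℕ, sqClass x = sqClass (-1 : ℚ) ^ a * sqClass (2 : ℚ) ^ b * sqClass (n : ℚ) ^ c := by
  have hN0 : (n : ℚ) ≠ 0 := by exact_mod_cast hn
  rcases h with ⟨r, h⟩ | ⟨r, h⟩
  · have hr : r ≠ 0 := by rintro rfl; rcases h with h | h | h | h <;> simp [h] at hx0
    rcases h with h | h | h | h
    · exact ⟨0, 0, 0, by rw [h, sqClass_sq]; simp⟩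
    · exact ⟨1, 0, 0, by rw [h, show -r ^ 2 = (-1 : ℚ) * r ^ 2 by ring, sqClass_mul_sq₂ (by norm_num) hr]; simp⟩
    · exact ⟨0, 0, 1, by rw [h, sqClass_mul_sq₂ hN0 hr]; simp⟩
    · exact ⟨1, 0, 1, by rw [h, show -((n : ℚ) * r ^ 2) = ((-1) * n) * r ^ 2 by ring, sqClass_mul_sq₂ (by simpa using hN0) hr,
        sqClass_mul (by norm_num) hN0]; simp⟩
  · have hr : r ≠ 0 := by rintro rfl; rcases h with h | h | h | h <;> simp [h] at hx0
    rcases h with h | h | h | h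
    · exact ⟨0, 1, 0, by rw [h, sqClass_mul_sq₂ (by norm_num) hr]; simp⟩
    · exact ⟨1, 1, 0, by rw [h, show -((2 : ℚ) * r ^ 2) = ((-1) * 2) * r ^ 2 by ring, sqClass_mul_sq₂ (by norm_num) hr,
        sqClass_mul (by norm_num) (by norm_num)]; simp⟩
    · exact ⟨0, 1, 1, by rw [h, sqClass_mul_sq₂ (by positivity) hr, sqClass_mul (by norm_num) hN0]; simp⟩
    · exact ⟨1, 1, 1, by rw [h, show -((2 : ℚ) * n * r ^ 2) = ((-1) * (2 * n)) * r ^ 2 by ring,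
        sqClass_mul_sq₂ (by simpa using hN0) hr, sqClass_mul (by norm_num) (by positivity), sqClass_mul (by norm_num) hN0]; simp [mul_assoc]⟩

/-- From the exponent form of the class of `x₀ ≠ 0` back to the eight-fold description. [folklore] -/
theorem exists_of_specialClass (hn : n ≠ 0) {x₀ : ℚ} (hx0 : x₀ ≠ 0)
    (h : ∃ a b c : ℕ, sqClass x₀ = sqClass (-1 : ℚ) ^ a * sqClass (2 : ℚ) ^ b * sqClass (n : ℚ) ^ c) :
    (∃ r : ℚ, x₀ = r ^ 2 ∨ x₀ = -r ^ 2 ∨ x₀ = n * r ^ 2 ∨ x₀ = -(n * r ^ 2)) ∨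
      (∃ r : ℚ, x₀ = 2 * r ^ 2 ∨ x₀ = -(2 * r ^ 2) ∨ x₀ = 2 * n * r ^ 2 ∨ x₀ = -(2 * n * r ^ 2)) := by
  have hN0 : (n : ℚ) ≠ 0 := by exact_mod_cast hn
  obtain ⟨a, b, c, h⟩ := h
  rw [sqUnits_pow_mod_two _ a, sqUnits_pow_mod_two _ b, sqUnits_pow_mod_two _ c] at h
  -- `[x₀] = [d]` with `d = (−1)^{a%2} 2^{b%2} n^{c%2}` gives `x₀ = d q²`
  have key : ∀ d : ℚ, d ≠ 0 → sqClass x₀ = sqClass d → ∃ q : ℚ, x₀ = d * q ^ 2 := by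
    intro d hd hcl
    have h1 : sqClass (x₀ * d) = 1 := by rw [sqClass_mul hx0 hd, hcl, SqUnits.mul_self]
    obtain ⟨u, hu⟩ := (sqClass_eq_one_iff (mul_ne_zero hx0 hd)).mp h1
    refine ⟨u / d, ?_⟩
    rw [div_pow, ← mul_div_assoc, eq_div_iff (pow_ne_zero 2 hd)]
    linear_combination d * hu
  have hcl : sqClass x₀ = sqClass ((-1 : ℚ) ^ (a % 2) * (2 : ℚ) ^ (b % 2) * (n : ℚ) ^ (c % 2)) := by
    rw [h, sqClass_mul (by positivity) (pow_ne_zero _ hN0), sqClass_mul (pow_ne_zero _ (by norm_num)) (pow_ne_zero _ (by norm_num))]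
    have e1 : ∀ (d : ℚ) (k : ℕ), d ≠ 0 → k < 2 → sqClass (d ^ k) = sqClass d ^ k := by
      intro d k hd hk
      interval_cases k
      · rw [pow_zero, pow_zero, ← mul_one (1 : ℚ), sqClass_mul_self]
      · rw [pow_one, pow_one]
    rw [e1 _ _ (by norm_num) (Nat.mod_lt a two_pos), e1 _ _ (by norm_num) (Nat.mod_lt b two_pos), e1 _ _ hN0 (Nat.mod_lt c two_pos)]
  have ha := Nat.mod_lt a two_pos; have hb := Nat.mod_lt b two_pos; have hc := Nat.mod_lt c two_pos
  obtain ⟨q, hq⟩ := key _ (by positivity) hcl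
  interval_cases ha : a % 2 <;> interval_cases hb : b % 2 <;> interval_cases hc : c % 2
  · exact Or.inl ⟨q, Or.inl (by rw [hq]; ring)⟩
  · exact Or.inl ⟨q, Or.inr (Or.inr (Or.inl (by rw [hq]; ring)))⟩
  · exact Or.inr ⟨q, Or.inl (by rw [hq]; ring)⟩
  · exact Or.inr ⟨q, Or.inr (Or.inr (Or.inl (by rw [hq]; ring)))⟩
  · exact Or.inl ⟨q, Or.inr (Or.inl (by rw [hq]; ring))⟩
  · exact Or.inl ⟨q, Or.inr (Or.inr (Or.inr (by rw [hq]; ring)))⟩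
  · exact Or.inr ⟨q, Or.inr (Or.inl (by rw [hq]; ring))⟩
  · exact Or.inr ⟨q, Or.inr (Or.inr (Or.inr (by rw [hq]; ring)))⟩

/-! ## §2 A witness point forces a generator with both exclusions -/

/-- The `x`-class of `m • P` is `1` or the `x`-class of `P`. [cite: SilvermanAEC2009, Prop. X.1.4] -/
theorem twoDescentComponent_zsmul_eq_or [(congruentNumberCurve n).IsElliptic] (P : (congruentNumberCurve n).toAffine.Point) (m : ℤ) :
    twoDescentComponent _ 0 (-(n : ℚ)) n (m • P) = 1 ∨
      twoDescentComponent _ 0 (-(n : ℚ)) n (m • P) = twoDescentComponent _ 0 (-(n : ℚ)) n P := by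
  have h0 := hsplit₂ n
  induction m using Int.induction_on with
  | zero => left; rw [zero_zsmul, twoDescentComponent_zero]
  | succ k ih =>
    rw [add_zsmul, one_zsmul, twoDescentComponent_add h0]
    rcases ih with h | h
    · right; rw [h, SqUnits.one_mul]
    · left; rw [h, SqUnits.mul_self]
  | pred k ih =>
    rw [sub_zsmul, one_zsmul, twoDescentComponent_add h0, twoDescentComponent_neg]
    rcases ih with h | h
    · right; rw [h, SqUnits.one_mul]
    · left; rw [h, SqUnits.mul_self]

/-- The `x`-class of a torsion point of `E_n(ℚ)` is a torsion class (square-free `n`: `E_n(ℚ)_tors = E_n[2] ⊆ φ_n(A_n(ℚ)) + E_n[2]`).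
[cite: Knapp1993, Ch. V, Thm. 5.2] [cite: TianYuanZhang2017, §1, definition of ρ(n)] -/
theorem specialClass_of_isOfFinAddOrder (hsq : Squarefree n) {t : (congruentNumberCurve n).toAffine.Point}
    (ht : haveI := isElliptic_congruentNumberCurve hsq.ne_zero; IsOfFinAddOrder t) :
    haveI := isElliptic_congruentNumberCurve hsq.ne_zero
    ∃ a b c : ℕ, twoDescentComponent _ 0 (-(n : ℚ)) n t = sqClass (-1 : ℚ) ^ a * sqClass (2 : ℚ) ^ b * sqClass (n : ℚ) ^ c := by
  haveI := isElliptic_congruentNumberCurve hsq.ne_zero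
  have hmem : t ∈ rhoSubgroup n :=
    AddSubgroup.subset_closure (Or.inr (two_nsmul_eq_zero_of_isOfFinAddOrder_congruentNumberCurve hsq ht))
  have hcl := sqClass_descentRep_of_mem_rhoSubgroup hsq.ne_zero hmem
  rw [← twoDescentComponent_eq_sqClass] at hcl
  exact specialClass_of_torsionClass hsq.ne_zero hcl

/-- The `x`-class of an affine point is special iff its abscissa is (eight-fold form); here the direction used below: class special ⟹
abscissa special. [cite: SilvermanAEC2009, Prop. X.1.4] -/
theorem exists_of_specialClass_point (hn : n ≠ 0) {x₀ y₀ : ℚ} (h₀ : (congruentNumberCurve n).toAffine.Nonsingular x₀ y₀)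
    (h : haveI := isElliptic_congruentNumberCurve hn;
      ∃ a b c : ℕ, twoDescentComponent _ 0 (-(n : ℚ)) n (Point.some x₀ y₀ h₀) =
        sqClass (-1 : ℚ) ^ a * sqClass (2 : ℚ) ^ b * sqClass (n : ℚ) ^ c) :
    (∃ r : ℚ, x₀ = r ^ 2 ∨ x₀ = -r ^ 2 ∨ x₀ = n * r ^ 2 ∨ x₀ = -(n * r ^ 2)) ∨
      (∃ r : ℚ, x₀ = 2 * r ^ 2 ∨ x₀ = -(2 * r ^ 2) ∨ x₀ = 2 * n * r ^ 2 ∨ x₀ = -(2 * n * r ^ 2)) := by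
  haveI := isElliptic_congruentNumberCurve hn
  by_cases hx0 : x₀ = 0
  · exact Or.inl ⟨0, Or.inl (by rw [hx0]; ring)⟩
  · rw [twoDescentComponent_some_of_ne _ hx0, sub_zero] at h
    exact exists_of_specialClass hn hx0 h

/-- **A witness point forces a generator with both exclusions.**  Square-free `n`, `rank E_n(ℚ) ≤ 1`, a rational point `(x₀, y₀)` with
`x₀ ∉ ⟨−1, 2, n⟩·ℚ^{×2}` ⟹ a generator `(x, y)` of `E_n(ℚ)` modulo torsion with `x ∉ {±1,±n}ℚ²` AND `x ∉ {±2,±2n}ℚ²`.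
[cite: SilvermanAEC2009, Prop. X.1.4] [cite: TianYuanZhang2017, §1 (p0002 L101–L110), §3.1 (p0011 L27–L36)] [cite: Knapp1993, Ch. V, Thm. 5.2] -/
theorem exists_generator_not_special₂_of_point (hsq : Squarefree n)
    (hr : haveI := isElliptic_congruentNumberCurve hsq.ne_zero; (congruentNumberCurve n).mordellWeilRank ≤ 1)
    {x₀ y₀ : ℚ} (h₀ : (congruentNumberCurve n).toAffine.Nonsingular x₀ y₀)
    (hx₀ : ¬ ∃ r : ℚ, x₀ = r ^ 2 ∨ x₀ = -r ^ 2 ∨ x₀ = n * r ^ 2 ∨ x₀ = -(n * r ^ 2))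
    (hx₀2 : ¬ ∃ r : ℚ, x₀ = 2 * r ^ 2 ∨ x₀ = -(2 * r ^ 2) ∨ x₀ = 2 * n * r ^ 2 ∨ x₀ = -(2 * n * r ^ 2)) :
    haveI := isElliptic_congruentNumberCurve hsq.ne_zero
    ∃ (x y : ℚ) (hxy : (congruentNumberCurve n).toAffine.Nonsingular x y),
      (∀ P, ∃ m : ℤ, IsOfFinAddOrder (P - m • (Point.some x y hxy : (congruentNumberCurve n).toAffine.Point))) ∧
      (¬ ∃ r : ℚ, x = r ^ 2 ∨ x = -r ^ 2 ∨ x = n * r ^ 2 ∨ x = -(n * r ^ 2)) ∧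
      (¬ ∃ r : ℚ, x = 2 * r ^ 2 ∨ x = -(2 * r ^ 2) ∨ x = 2 * n * r ^ 2 ∨ x = -(2 * n * r ^ 2)) := by
  haveI := isElliptic_congruentNumberCurve hsq.ne_zero
  have hn := hsq.ne_zero
  have h0 := hsplit₂ n
  set P₀ : (congruentNumberCurve n).toAffine.Point := Point.some x₀ y₀ h₀ with hP₀
  -- the witness is not special, in class form
  have hw : ¬ ∃ a b c : ℕ, twoDescentComponent _ 0 (-(n : ℚ)) n P₀ =
      sqClass (-1 : ℚ) ^ a * sqClass (2 : ℚ) ^ b * sqClass (n : ℚ) ^ c := by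
    intro h
    rcases exists_of_specialClass_point hn h₀ h with h1 | h2
    · exact hx₀ h1
    · exact hx₀2 h2
  obtain ⟨R, hR⟩ := W2.stub_S0 (n := n) hr
  -- the class of `P₀ = (P₀ - m•R) + m•R`
  obtain ⟨m, hm⟩ := hR P₀
  have hdec : twoDescentComponent _ 0 (-(n : ℚ)) n P₀ =
      twoDescentComponent _ 0 (-(n : ℚ)) n (P₀ - m • R) * twoDescentComponent _ 0 (-(n : ℚ)) n (m • R) := by
    rw [← twoDescentComponent_add h0, sub_add_cancel]
  have htors := specialClass_of_isOfFinAddOrder hsq hm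
  rcases R with _ | ⟨x, y, hxy⟩
  · -- `R = O`: `P₀` is torsion up to `m • O = O`, hence special — contradiction
    exfalso; apply hw
    have ht' := htors
    rw [← WeierstrassCurve.Affine.Point.zero_def, zsmul_zero] at ht'
    rw [hdec, ← WeierstrassCurve.Affine.Point.zero_def, zsmul_zero, twoDescentComponent_zero, SqUnits.mul_one]
    exact ht'
  · refine ⟨x, y, hxy, hR, ?_, ?_⟩ <;> intro hxs <;> apply hw
    all_goals
      have hRcl : ∃ a b c : ℕ, twoDescentComponent _ 0 (-(n : ℚ)) n (Point.some x y hxy) =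
          sqClass (-1 : ℚ) ^ a * sqClass (2 : ℚ) ^ b * sqClass (n : ℚ) ^ c := by
        by_cases hx0 : x = 0
        · -- `(0,0)`: class `[−n²] = [−1]`
          refine ⟨1, 0, 0, ?_⟩
          rw [twoDescentComponent_some_of_eq _ hx0, show ((0 : ℚ) - -(n : ℚ)) * (0 - n) = (-1) * (n : ℚ) ^ 2 by ring,
            sqClass_mul_sq₂ (by norm_num) (by exact_mod_cast hn)]
          simp
        · rw [twoDescentComponent_some_of_ne _ hx0, sub_zero]
          first
            | exact specialClass_of_exists hn hx0 (Or.inl hxs)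
            | exact specialClass_of_exists hn hx0 (Or.inr hxs)
      rw [hdec]
      refine specialClass_mul htors ?_
      rcases twoDescentComponent_zsmul_eq_or (Point.some x y hxy) m with h1 | h1
      · exact ⟨0, 0, 0, by rw [h1]; simp⟩
      · rw [h1]; exact hRcl

/-! ## §3 The even lower half of C⁺ from one witness point -/

variable {k : ℕ} (p : Fin k → ℕ) (hp : ∀ i, (p i).Prime) (hodd : ∀ i, Odd (p i)) (hinj : Function.Injective p)

include hp hodd hinj in
/-- **THE EVEN LOWER HALF OF C⁺, ALL `k`, FROM ONE WITNESS POINT** (g14's `MoverAssembly.two_dvd_scriptL_even_allk_of_facts` with the generator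
replaced by a witness).  Granted `tyz_cmPointRingClassFrobeniusValueData ∧ thm11_parity_of_scriptL ∧ GZK`: for `n = 2∏pᵢ` square-free (distinct odd
primes, `∏pᵢ ≡ 3 (4)`), `#Sel₂(E_n/ℚ) = 2^{2+s}` with `s ≥ 2`, `ord_{s=1} L(E_n, s) = 1`, and ANY rational point `(x₀, y₀) ∈ E_n(ℚ)` with
`x₀ ∉ {±1, ±n, ±2, ±2n}·ℚ^{×2}`: `2 ∣ L` whenever `𝓛(n)² = L²`. [cite: TianYuanZhang2017, Thm. 1.1, §3] [cite: Darmon2004, Thm. 3.22]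
[cite: SilvermanAEC2009, Prop. X.1.4] -/
theorem two_dvd_scriptL_even_allk_of_point_of_facts
    (hF : tyz_cmPointRingClassFrobeniusValueData ∧ thm11_parity_of_scriptL ∧ rank_eq_analyticRank_of_analyticRank_le_one)
    (hn : n = 2 * ∏ i, p i) (h3 : (∏ i, p i) % 4 = 3) (hsq : Squarefree n)
    {s : ℕ} (hs : 2 ≤ s) (hsel : Nat.card ((congruentNumberCurve n).selmerGroup 2) = 2 ^ (2 + s))
    (hra : haveI := isElliptic_congruentNumberCurve hsq.ne_zero; (congruentNumberCurve n).analyticRank = 1)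
    {x₀ y₀ : ℚ} (h₀ : (congruentNumberCurve n).toAffine.Nonsingular x₀ y₀)
    (hx₀ : ¬ ∃ r : ℚ, x₀ = r ^ 2 ∨ x₀ = -r ^ 2 ∨ x₀ = n * r ^ 2 ∨ x₀ = -(n * r ^ 2))
    (hx₀2 : ¬ ∃ r : ℚ, x₀ = 2 * r ^ 2 ∨ x₀ = -(2 * r ^ 2) ∨ x₀ = 2 * n * r ^ 2 ∨ x₀ = -(2 * n * r ^ 2)) :
    ∀ L : ℤ, IsScriptL n L → (2 : ℤ) ∣ L := by
  haveI := isElliptic_congruentNumberCurve hsq.ne_zero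
  have hrk : (congruentNumberCurve n).mordellWeilRank ≤ 1 := by
    have h := (hF.2.2 (congruentNumberCurve n) (by rw [hra])).1
    rw [h, hra]
  obtain ⟨x, y, hxy, hgen, hx, hx2⟩ := exists_generator_not_special₂_of_point hsq hrk h₀ hx₀ hx₀2
  exact MoverAssembly.two_dvd_scriptL_even_allk_of_facts p hp hodd hinj hF hn h3 hsq hs hsel hra hxy hgen hx hx2

end Summit.BirchSwinnertonDyer.PrintCf2.SpecialStratum

end
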